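import Literature.AlgebraicGeometry.Motives.CoherentFracLine
import HarnessLib

/-!
# The rank-one piece at an associated point as a coherent family on `closure {ζ}`
# (rank-one dévissage of coherent modules, The Stacks Project Tag 01YF, step three)

Conclusion of `Motives/CoherentFracColon` and `Motives/CoherentFracLine`. For coherent families
`L' ≤ L` of rational functions on the intersections `𝔘` of a finite affine cover of an integral
locally Noetherian scheme `Z`, a minimal associated point `ζ` of `𝓛/𝓛'`, and the line family
`𝓛₁ = lineFam` (`L' < 𝓛₁ ≤ L`) with its residue map `lineRes : 𝓛'_ζ + 𝒪_ζ x₂ → K(Z₁)`,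
`Z₁ = closure {ζ}` (`FracFamily.PointRes.sub ζ`), this file produces the graded piece
`𝓛₁/𝓛' ≅ (Z₁ ↪ Z)_* 𝓖₁` as a COHERENT FAMILY on `Z₁`:

* `FracFamily.SubIdx 𝔘 ζ = {a | ζ ∈ U_{a}}` — the vertex charts meeting `Z₁`, an order-embedded
  sub-index type `subEmb : SubIdx ↪o ι`; `FracFamily.subCover` — the induced cover data on `Z₁`
  (preimages of the `U_t`, `t ⊆ SubIdx`; affine because `Z₁ ↪ Z` is affine, containing the generic
  point of `Z₁` because it lies over `ζ`);
* `FracFamily.pieceFam s = lineRes (Γ(U_{e s}, 𝓛₁)) ⊆ K(Z₁)` and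
  `FracFamily.isCoherent_pieceFam` — **the piece is a coherent family on `Z₁`** (sections of `Z₁`
  over affine charts lift to `Z`, Mathlib `Scheme.Hom.app_surjective`; stalk independence from
  that of `𝓛₁` and the multiplicativity `lineRes (b x) = b̄ · lineRes x`);
* `FracFamily.pieceMap s : Γ(U_{e s}, 𝓛₁) →ₗ[A] pieceFam s` with the four hypotheses of the short
  exact sequence of Čech complexes `0 → Č(L') → Č(𝓛₁) → Č_{SubIdx}(pieceFam) → 0`
  (`Literature/Algebra/Homology/OrderedCechPieces`, `OrderedCech.shortExact_pieceSCNE`):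
  compatibility (`pieceMap_compat`), kernels `= L'` (`pieceMap_eq_zero_iff`, from
  `lineRes_eq_zero_iff`), surjectivity (`pieceMap_surjective`) and `𝓛₁ = 𝓛'` on the simplices
  outside `SubIdx` (`lineFam_le_of_forall_ne`);
* `one_mem_pieceFam` (the piece is non-zero: `lineRes x₂ = 1`) and
  `isRegularAt_algebraMap_sub` (scalars of `A` stay regular on `Z₁`), the hypotheses under which
  the induction on `Z₁` continues.

Everything is proved; no named facts. Mathlib searched (pin v4.32): `Scheme.Hom.app_surjective`,
`IsAffineOpen.preimage`, `OrderEmbedding.subtype`, `Finset.subtype_map`, `Fintype.ofFinite` (used).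

## References

* The Stacks Project, Tag 01YF (dévissage of coherent modules on Noetherian schemes).
* U. Görtz, T. Wedhorn, *Algebraic Geometry I: Schemes*, 2nd ed. (2020), Lemma 12.63 (PDF p. 436);
  *Algebraic Geometry II* (2023), Thm. 23.17, proof (PDF pp. 424–425). [GortzWedhorn2020]
  [GortzWedhorn2023]
-/

universe u v

open CategoryTheory AlgebraicGeometry TopologicalSpace Opposite

noncomputable section

namespace Literature.AlgebraicGeometry.Motives

namespace FracFamily

open RatFn

variable {Z : Scheme.{u}} [IsIntegral Z]

/-! ### The vertex charts through `ζ` and the induced cover of `closure {ζ}` -/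

section SubCover

variable {ι : Type} [LinearOrder ι] (𝔘 : CoverData Z ι) (ζ : Z)

/-- **The vertex charts through `ζ`**: indices `a` with `ζ ∈ U_{a}` (the members of the cover
meeting `closure {ζ}`). [folklore] -/
def SubIdx : Type := {a : ι // ζ ∈ 𝔘.U {a}}

/-- The induced linear order. [folklore] -/
instance : LinearOrder (SubIdx 𝔘 ζ) := inferInstanceAs (LinearOrder {a : ι // ζ ∈ 𝔘.U {a}})

/-- Finiteness of the sub-index type. [folklore] -/
instance [Fintype ι] : Fintype (SubIdx 𝔘 ζ) :=
  haveI : Finite {a : ι // ζ ∈ 𝔘.U {a}} := inferInstance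
  Fintype.ofFinite {a : ι // ζ ∈ 𝔘.U {a}}

/-- The order embedding `SubIdx ↪o ι`. [folklore] -/
def subEmb : SubIdx 𝔘 ζ ↪o ι := OrderEmbedding.subtype _

/-- `subEmb` is the subtype inclusion. [folklore] -/
@[simp] theorem subEmb_apply (a : SubIdx 𝔘 ζ) : subEmb 𝔘 ζ a = a.1 := rfl

/-- `ζ` lies in `U_{e s}` for every NON-EMPTY `s ⊆ SubIdx`. [folklore] -/
theorem mem_U_map {s : Finset (SubIdx 𝔘 ζ)} (hs : s.Nonempty) :
    ζ ∈ 𝔘.U (s.map (subEmb 𝔘 ζ).toEmbedding) :=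
  𝔘.mem_of_forall (Finset.map_nonempty.2 hs) fun b hb => by
    obtain ⟨a, -, rfl⟩ := Finset.mem_map.1 hb
    exact a.2

/-- `ζ` lies in `U_{e s}` for every `s ⊆ SubIdx`, given `U_∅ = Z`. [folklore] -/
theorem mem_U_map' (h0 : 𝔘.U ∅ = ⊤) (s : Finset (SubIdx 𝔘 ζ)) :
    ζ ∈ 𝔘.U (s.map (subEmb 𝔘 ζ).toEmbedding) := by
  rcases s.eq_empty_or_nonempty with rfl | hs
  · rw [Finset.map_empty, h0]; trivial
  · exact mem_U_map 𝔘 ζ hs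

/-- **A simplex all of whose vertices are charts through `ζ` comes from `SubIdx`.** [folklore] -/
theorem exists_map_eq_of_forall {t : Finset ι} (ht : ∀ a ∈ t, ζ ∈ 𝔘.U {a}) :
    ∃ s : Finset (SubIdx 𝔘 ζ), s.map (subEmb 𝔘 ζ).toEmbedding = t := by
  classical
  refine ⟨t.subtype _, ?_⟩
  change (t.subtype fun a => ζ ∈ 𝔘.U {a}).map (Function.Embedding.subtype _) = t
  rw [Finset.subtype_map]
  exact Finset.filter_true_of_mem ht

/-- **The cover data induced on `Z₁ = closure {ζ}`**: preimages of the `U_t`, `t ⊆ SubIdx`,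
under `Z₁ ↪ Z` (given `U_∅ = Z`, so that all members contain the generic point of `Z₁`).
[folklore] -/
def subCover (h0 : 𝔘.U ∅ = ⊤) : CoverData (PointRes.sub ζ) (SubIdx 𝔘 ζ) where
  U s := (PointRes.incl ζ) ⁻¹ᵁ 𝔘.U (s.map (subEmb 𝔘 ζ).toEmbedding)
  anti _ _ hst := Scheme.Hom.preimage_mono _ (𝔘.anti (Finset.map_subset_map.2 hst))
  mem_of_forall t ht y hy := by
    change PointRes.incl ζ y ∈ 𝔘.U (t.map (subEmb 𝔘 ζ).toEmbedding)
    refine 𝔘.mem_of_forall (Finset.map_nonempty.2 ht) fun b hb => ?_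
    obtain ⟨a, ha, rfl⟩ := Finset.mem_map.1 hb
    have := hy a ha
    change PointRes.incl ζ y ∈ 𝔘.U (({a} : Finset _).map (subEmb 𝔘 ζ).toEmbedding) at this
    rwa [Finset.map_singleton] at this
  affine _ ht := (𝔘.affine (Finset.map_nonempty.2 ht)).preimage _
  genericPoint_mem t := PointRes.genericPoint_mem_preimage ζ (mem_U_map' 𝔘 ζ h0 t)
  exists_mem y := by
    obtain ⟨a, ha⟩ := 𝔘.exists_mem (PointRes.incl ζ y)
    have hζ : ζ ∈ 𝔘.U {a} := mem_of_specializes_of_mem (PointRes.specializes_incl ζ y) ha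
    refine ⟨⟨a, hζ⟩, ?_⟩
    change PointRes.incl ζ y ∈ 𝔘.U (({⟨a, hζ⟩} : Finset (SubIdx 𝔘 ζ)).map (subEmb 𝔘 ζ).toEmbedding)
    rw [Finset.map_singleton]
    exact ha

/-- The members of `subCover`. [folklore] -/
theorem subCover_U (h0 : 𝔘.U ∅ = ⊤) (s : Finset (SubIdx 𝔘 ζ)) :
    (subCover 𝔘 ζ h0).U s = (PointRes.incl ζ) ⁻¹ᵁ 𝔘.U (s.map (subEmb 𝔘 ζ).toEmbedding) := rfl

/-- `subCover` again satisfies `U_∅ = Z₁`. [folklore] -/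
theorem subCover_U_empty (h0 : 𝔘.U ∅ = ⊤) : (subCover 𝔘 ζ h0).U ∅ = ⊤ := by
  rw [subCover_U, Finset.map_empty, h0]; rfl

end SubCover

/-! ### The piece family and its coherence -/

section Piece

variable {A : Type v} [CommRing A] [Algebra A Z.functionField]
variable {ι : Type} [LinearOrder ι] {𝔘 : CoverData Z ι} {ζ : Z}
  {L L' : Finset ι → Submodule A Z.functionField} {a₀ : ι} {x₂ : Z.functionField}
variable [Algebra A (PointRes.sub ζ).functionField]
variable (hL : IsCoherent 𝔘 L) (hL' : IsCoherent 𝔘 L') (hle : ∀ t, L' t ≤ L t)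
variable (hA : ∀ (a : A) (y : Z), IsRegularAt y (algebraMap A Z.functionField a))
variable (hζa : ζ ∈ 𝔘.U {a₀}) (hx₂ : x₂ ∈ colonFam 𝔘 ζ L L' {a₀})
  (hx₂' : x₂ ∉ stalkSpan (A := A) ζ (L' {a₀} : Set Z.functionField))
variable (hAc : ∀ a : A, PointRes.res ζ (hA a ζ) = algebraMap A (PointRes.sub ζ).functionField a)
variable (h0 : 𝔘.U ∅ = ⊤)

include hA hAc in
/-- **Scalars of `A` stay regular on `Z₁`** (they are pull-backs of global sections of `Z`).
[folklore] -/
theorem isRegularAt_algebraMap_sub (a : A) (y : PointRes.sub ζ) :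
    IsRegularAt y (algebraMap A (PointRes.sub ζ).functionField a) := by
  obtain ⟨c, hc⟩ := IsCoherent.exists_smul_eq_algebraMap_mul (A := A) hA ⊤ trivial a
  haveI : Nonempty (⊤ : Z.Opens) := ⟨⟨ζ, trivial⟩⟩
  have e : algebraMap A Z.functionField a = algebraMap Γ(Z, ⊤) Z.functionField c := by
    have := hc 1
    rwa [Algebra.smul_def, mul_one, mul_one] at this
  rw [← hAc a, PointRes.res_congr ζ (hA a ζ) (e ▸ hA a ζ) e,
    PointRes.res_algebraMap ζ (Set.mem_univ ζ) c]
  haveI : Nonempty ((PointRes.incl ζ) ⁻¹ᵁ (⊤ : Z.Opens)) := ⟨⟨y, trivial⟩⟩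
  exact isRegularAt_algebraMap_sections (⟨y, trivial⟩ : (PointRes.incl ζ) ⁻¹ᵁ (⊤ : Z.Opens)) _

variable (𝔘 ζ L L' a₀ x₂) in
omit [Algebra A (PointRes.sub ζ).functionField] in
include h0 in
/-- Every `lineFam (e s)` lies in the domain of `lineRes` (`ζ ∈ U_{e s}`). [folklore] -/
theorem lineFam_map_le (s : Finset (SubIdx 𝔘 ζ)) :
    lineFam 𝔘 ζ L L' a₀ x₂ (s.map (subEmb 𝔘 ζ).toEmbedding) ≤ lineSpan (A := A) ζ L' a₀ x₂ :=
  fun _ hx => hx.2 (mem_U_map' 𝔘 ζ h0 s)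

/-- **The piece family** `s ↦ lineRes (Γ(U_{e s}, 𝓛₁)) ⊆ K(Z₁)`. [folklore] -/
def pieceFam (s : Finset (SubIdx 𝔘 ζ)) : Submodule A (PointRes.sub ζ).functionField :=
  ((lineFam 𝔘 ζ L L' a₀ x₂ (s.map (subEmb 𝔘 ζ).toEmbedding)).comap
    (lineSpan (A := A) ζ L' a₀ x₂).subtype).map (lineRes hA hx₂' hAc)

/-- Membership in the piece family. [folklore] -/
theorem mem_pieceFam_iff {s : Finset (SubIdx 𝔘 ζ)} {g : (PointRes.sub ζ).functionField} :
    g ∈ pieceFam (L := L) hA hx₂' hAc s ↔ ∃ (x : Z.functionField)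
      (hx : x ∈ lineFam 𝔘 ζ L L' a₀ x₂ (s.map (subEmb 𝔘 ζ).toEmbedding)),
        lineRes hA hx₂' hAc ⟨x, lineFam_map_le 𝔘 ζ L L' a₀ x₂ h0 s hx⟩ = g := by
  unfold pieceFam
  rw [Submodule.mem_map]
  constructor
  · rintro ⟨y, hy, rfl⟩
    exact ⟨y.1, hy, rfl⟩
  · rintro ⟨x, hx, rfl⟩
    exact ⟨⟨x, _⟩, hx, rfl⟩

include h0 in
/-- `lineRes x ∈ pieceFam s` for `x ∈ lineFam (e s)`. [folklore] -/
theorem lineRes_mem_pieceFam {s : Finset (SubIdx 𝔘 ζ)} {x : Z.functionField}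
    (hx : x ∈ lineFam 𝔘 ζ L L' a₀ x₂ (s.map (subEmb 𝔘 ζ).toEmbedding))
    (hx' : x ∈ lineSpan (A := A) ζ L' a₀ x₂) :
    lineRes hA hx₂' hAc ⟨x, hx'⟩ ∈ pieceFam (L := L) hA hx₂' hAc s := by
  rw [mem_pieceFam_iff (h0 := h0)]
  exact ⟨x, hx, rfl⟩

/-- **The maps `Γ(U_{e s}, 𝓛₁) → pieceFam s`** (restriction of `lineRes`). [folklore] -/
def pieceMap (s : Finset (SubIdx 𝔘 ζ)) :
    lineFam 𝔘 ζ L L' a₀ x₂ (s.map (subEmb 𝔘 ζ).toEmbedding) →ₗ[A] pieceFam (L := L) hA hx₂' hAc s :=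
  LinearMap.codRestrict _
    (lineRes hA hx₂' hAc ∘ₗ Submodule.inclusion (lineFam_map_le 𝔘 ζ L L' a₀ x₂ h0 s))
    fun x => lineRes_mem_pieceFam hA hx₂' hAc h0 x.2 _

/-- The value of `pieceMap`. [folklore] -/
@[simp] theorem coe_pieceMap (s : Finset (SubIdx 𝔘 ζ))
    (x : lineFam 𝔘 ζ L L' a₀ x₂ (s.map (subEmb 𝔘 ζ).toEmbedding)) :
    ((pieceMap (L := L) hA hx₂' hAc h0 s x : pieceFam (L := L) hA hx₂' hAc s) :
      (PointRes.sub ζ).functionField) =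
      lineRes hA hx₂' hAc ⟨x, lineFam_map_le 𝔘 ζ L L' a₀ x₂ h0 s x.2⟩ := rfl

/-- **Compatibility of the `pieceMap` with the inclusions** (they are all `lineRes`). [folklore] -/
theorem pieceMap_compat (hlm : Monotone (lineFam 𝔘 ζ L L' a₀ x₂)) :
    ∀ ⦃s t : Finset (SubIdx 𝔘 ζ)⦄, s.Nonempty → ∀ (hst : s ⊆ t) (x : Z.functionField)
      (hx : x ∈ lineFam 𝔘 ζ L L' a₀ x₂ (s.map (subEmb 𝔘 ζ).toEmbedding)),
      ((pieceMap (L := L) hA hx₂' hAc h0 t ⟨x, hlm (Finset.map_subset_map.2 hst) hx⟩ :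
        pieceFam (L := L) hA hx₂' hAc t) : (PointRes.sub ζ).functionField) =
        (pieceMap (L := L) hA hx₂' hAc h0 s ⟨x, hx⟩ : (PointRes.sub ζ).functionField) :=
  fun _ _ _ _ _ _ => rfl

/-- **`pieceMap s` is onto `pieceFam s`.** [folklore] -/
theorem pieceMap_surjective (s : Finset (SubIdx 𝔘 ζ)) (_hs : s.Nonempty) :
    Function.Surjective (pieceMap (L := L) hA hx₂' hAc h0 s) := by
  rintro ⟨g, hg⟩
  obtain ⟨x, hx, rfl⟩ := (mem_pieceFam_iff hA hx₂' hAc h0).1 hg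
  exact ⟨⟨x, hx⟩, rfl⟩

include hL hL' hζa hx₂ in
/-- **The kernel of `pieceMap s` is `L' (e s)`** (`ζ` a minimal associated point). [folklore] -/
theorem pieceMap_eq_zero_iff [IsLocallyNoetherian Z]
    (hmin : ∀ y : Z, IsAssPt (A := A) 𝔘 L L' y → ζ ⤳ y → y = ζ)
    (s : Finset (SubIdx 𝔘 ζ)) (hs : s.Nonempty)
    (x : lineFam 𝔘 ζ L L' a₀ x₂ (s.map (subEmb 𝔘 ζ).toEmbedding)) :
    pieceMap (L := L) hA hx₂' hAc h0 s x = 0 ↔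
      (x : Z.functionField) ∈ L' (s.map (subEmb 𝔘 ζ).toEmbedding) := by
  rw [← lineRes_eq_zero_iff hL hL' hA hζa hx₂ hx₂' hAc hmin (Finset.map_nonempty.2 hs)
    (mem_U_map 𝔘 ζ hs) x.2, Subtype.ext_iff, coe_pieceMap]
  rfl

omit [Algebra A (PointRes.sub ζ).functionField] in
include hL' hle hζa in
/-- **On the simplices outside `SubIdx` the line family is `L'`**: a non-empty `t` not of the form
`e s` has a vertex chart missing `ζ`, hence `ζ ∉ U_t`. [folklore] -/
theorem lineFam_le_of_forall_ne (t : Finset ι) (ht : t.Nonempty)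
    (hne : ∀ s : Finset (SubIdx 𝔘 ζ), s.map (subEmb 𝔘 ζ).toEmbedding ≠ t) :
    lineFam 𝔘 ζ L L' a₀ x₂ t ≤ L' t := by
  have hζt : ζ ∉ 𝔘.U t := fun hζt => by
    obtain ⟨s, hs⟩ := exists_map_eq_of_forall 𝔘 ζ (t := t) fun a ha => 𝔘.le_single ha hζt
    exact hne s hs
  exact (lineFam_eq_of_notMem hL' hle hζa ht hζt).le

include hx₂ h0 in
/-- **The piece is non-zero**: `1 = lineRes x₂ ∈ pieceFam {a₀}`. [folklore] -/
theorem one_mem_pieceFam : (1 : (PointRes.sub ζ).functionField) ∈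
    pieceFam (L := L) hA hx₂' hAc {⟨a₀, hζa⟩} := by
  rw [mem_pieceFam_iff (h0 := h0)]
  refine ⟨x₂, ?_, ?_⟩
  · rw [Finset.map_singleton]
    exact mem_lineFam_self hx₂
  · exact lineRes_self hA hx₂' hAc

include hL hL' hle hζa in
set_option maxHeartbeats 400000 in
/-- **The piece family is coherent on `Z₁`.** [folklore] -/
theorem isCoherent_pieceFam [IsLocallyNoetherian Z] :
    IsCoherent (subCover 𝔘 ζ h0) (pieceFam (L := L) hA hx₂' hAc) where
  mono s t hst := Submodule.map_mono (Submodule.comap_mono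
    (lineFam_mono hL.mono hL'.mono (Finset.map_subset_map.2 hst)))
  smul_mem s hs b₁ g hg := by
    classical
    obtain ⟨x, hx, rfl⟩ := (mem_pieceFam_iff hA hx₂' hAc h0).1 hg
    set U := 𝔘.U (s.map (subEmb 𝔘 ζ).toEmbedding) with hU
    have hUaff : IsAffineOpen U := 𝔘.affine (Finset.map_nonempty.2 hs)
    obtain ⟨b, rfl⟩ := (PointRes.incl ζ).app_surjective U hUaff b₁
    have hζU : ζ ∈ U := mem_U_map 𝔘 ζ hs
    have hbx : algebraMap Γ(Z, U) Z.functionField b * x ∈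
        lineFam 𝔘 ζ L L' a₀ x₂ (s.map (subEmb 𝔘 ζ).toEmbedding) :=
      algebraMap_mul_mem_lineFam hL (Finset.map_nonempty.2 hs) b hx
    haveI : Nonempty ((PointRes.incl ζ) ⁻¹ᵁ U) := ⟨⟨_, PointRes.genericPoint_mem_preimage ζ hζU⟩⟩
    have key : lineRes hA hx₂' hAc ⟨_, lineFam_map_le 𝔘 ζ L L' a₀ x₂ h0 s hbx⟩ =
        algebraMap Γ(PointRes.sub ζ, (PointRes.incl ζ) ⁻¹ᵁ U) (PointRes.sub ζ).functionField
          ((PointRes.incl ζ).app U b) * lineRes hA hx₂' hAc ⟨x, lineFam_map_le 𝔘 ζ L L' a₀ x₂ h0 s hx⟩ :=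
      lineRes_algebraMap_mul hA hx₂' hAc hζU b ⟨x, lineFam_map_le 𝔘 ζ L L' a₀ x₂ h0 s hx⟩
        (lineFam_map_le 𝔘 ζ L L' a₀ x₂ h0 s hbx)
    have hmem := lineRes_mem_pieceFam hA hx₂' hAc h0 hbx (lineFam_map_le 𝔘 ζ L L' a₀ x₂ h0 s hbx)
    rw [key] at hmem
    exact hmem
  fg s hs := by
    classical
    have hlc := isCoherent_lineFam hL hL' hle hζa hA (x₂ := x₂)
    obtain ⟨S, hS, hSeq⟩ := hlc.exists_finset_eq_chartSpan (Finset.map_nonempty.2 hs)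
    set U := 𝔘.U (s.map (subEmb 𝔘 ζ).toEmbedding) with hU
    have hζU : ζ ∈ U := mem_U_map 𝔘 ζ hs
    have hle₁ := lineFam_map_le 𝔘 ζ L L' a₀ x₂ h0 s (A := A)
    let φ : Z.functionField → (PointRes.sub ζ).functionField := fun w =>
      if hw : w ∈ lineSpan (A := A) ζ L' a₀ x₂ then lineRes hA hx₂' hAc ⟨w, hw⟩ else 0
    refine ⟨S.image φ, ?_, ?_⟩
    · intro g hg
      obtain ⟨w, hw, rfl⟩ := Finset.mem_image.1 (Finset.mem_coe.1 hg)
      have hwL : w ∈ lineFam 𝔘 ζ L L' a₀ x₂ (s.map (subEmb 𝔘 ζ).toEmbedding) := hS hw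
      change φ w ∈ pieceFam (L := L) hA hx₂' hAc s
      simp only [φ, dif_pos (hle₁ hwL)]
      exact lineRes_mem_pieceFam hA hx₂' hAc h0 hwL _
    · intro g hg
      obtain ⟨x, hx, rfl⟩ := (mem_pieceFam_iff hA hx₂' hAc h0).1 hg
      have hxc : x ∈ chartSpan (A := A) U (S : Set Z.functionField) := hSeq ▸ hx
      have hcl : chartSpan (A := A) U (S : Set Z.functionField) ≤ lineSpan (A := A) ζ L' a₀ x₂ :=
        fun w hw => hle₁ (hSeq ▸ hw)
      haveI : Nonempty ((PointRes.incl ζ) ⁻¹ᵁ U) := ⟨⟨_, PointRes.genericPoint_mem_preimage ζ hζU⟩⟩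
      -- the `A`-linear map `Γ(U) · S → K(Z₁)`
      let Φ : chartSpan (A := A) U (S : Set Z.functionField) →ₗ[A] (PointRes.sub ζ).functionField :=
        lineRes hA hx₂' hAc ∘ₗ Submodule.inclusion hcl
      have hΦ : ∀ (w : Z.functionField) (hw : w ∈ chartSpan (A := A) U (S : Set Z.functionField)),
          Φ ⟨w, hw⟩ = lineRes hA hx₂' hAc ⟨w, hcl hw⟩ := fun _ _ => rfl
      suffices h : ∀ (w : Z.functionField) (hw : w ∈ chartSpan (A := A) U (S : Set Z.functionField)),
          Φ ⟨w, hw⟩ ∈ chartSpan (A := A) ((subCover 𝔘 ζ h0).U s) ((S.image φ : Finset _) : Set _) by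
        have := h x hxc
        rwa [hΦ] at this
      intro w hw
      induction hw using Submodule.span_induction with
      | mem w hw =>
        obtain ⟨b, w', hw', rfl⟩ := hw
        have hw'L : w' ∈ lineFam 𝔘 ζ L L' a₀ x₂ (s.map (subEmb 𝔘 ζ).toEmbedding) := hS hw'
        have hbw : algebraMap Γ(Z, U) Z.functionField b * w' ∈ lineSpan (A := A) ζ L' a₀ x₂ :=
          hle₁ (algebraMap_mul_mem_lineFam hL (Finset.map_nonempty.2 hs) b hw'L)
        have key : lineRes hA hx₂' hAc ⟨_, hbw⟩ =
            algebraMap Γ(PointRes.sub ζ, (PointRes.incl ζ) ⁻¹ᵁ U) (PointRes.sub ζ).functionField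
              ((PointRes.incl ζ).app U b) * lineRes hA hx₂' hAc ⟨w', hle₁ hw'L⟩ :=
          lineRes_algebraMap_mul hA hx₂' hAc hζU b ⟨w', hle₁ hw'L⟩ hbw
        rw [hΦ, key]
        refine algebraMap_mul_mem_chartSpan _ _ (subset_chartSpan _ _ ?_)
        refine Finset.mem_coe.2 (Finset.mem_image.2 ⟨w', hw', ?_⟩)
        simp only [φ, dif_pos (hle₁ hw'L)]
      | zero =>
        have e : ∀ h, (⟨0, h⟩ : chartSpan (A := A) U (S : Set Z.functionField)) = 0 :=
          fun _ => Subtype.ext rfl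
        rw [e, map_zero]
        exact Submodule.zero_mem _
      | add w w' hw hw' ihw ihw' =>
        have e : ∀ h, (⟨w + w', h⟩ : chartSpan (A := A) U (S : Set Z.functionField)) =
            ⟨w, hw⟩ + ⟨w', hw'⟩ := fun _ => Subtype.ext rfl
        rw [e, map_add]
        exact Submodule.add_mem _ ihw ihw'
      | smul a w hw ihw =>
        have e : ∀ h, (⟨a • w, h⟩ : chartSpan (A := A) U (S : Set Z.functionField)) =
            a • ⟨w, hw⟩ := fun _ => Subtype.ext rfl
        rw [e, map_smul]
        exact Submodule.smul_mem _ a ihw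
  stalk_le s t hs hst y hy := by
    classical
    have ht : t.Nonempty := hs.mono hst
    have hlc := isCoherent_lineFam hL hL' hle hζa hA (x₂ := x₂)
    set Us := 𝔘.U (s.map (subEmb 𝔘 ζ).toEmbedding) with hUs
    have hζs : ζ ∈ Us := mem_U_map 𝔘 ζ hs
    have hyt : PointRes.incl ζ y ∈ 𝔘.U (t.map (subEmb 𝔘 ζ).toEmbedding) := hy
    have hys : PointRes.incl ζ y ∈ Us := 𝔘.anti (Finset.map_subset_map.2 hst) hyt
    have hNs : ∀ (b : Γ(Z, Us)) z, z ∈ lineFam 𝔘 ζ L L' a₀ x₂ (s.map (subEmb 𝔘 ζ).toEmbedding) →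
        algebraMap Γ(Z, Us) Z.functionField b * z ∈
          lineFam 𝔘 ζ L L' a₀ x₂ (s.map (subEmb 𝔘 ζ).toEmbedding) :=
      fun b z hz => algebraMap_mul_mem_lineFam hL (Finset.map_nonempty.2 hs) b hz
    refine stalkSpan_le (fun g hg => ?_) fun f z hf hz => isRegularAt_mul_mem_stalkSpan hf hz
    obtain ⟨x, hx, rfl⟩ := (mem_pieceFam_iff hA hx₂' hAc h0).1 hg
    -- push `x` into `lineFam (e s)` with a denominator non-vanishing at `y`
    have hxs : x ∈ stalkSpan (A := A) (PointRes.incl ζ y)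
        (lineFam 𝔘 ζ L L' a₀ x₂ (s.map (subEmb 𝔘 ζ).toEmbedding) : Set Z.functionField) :=
      hlc.stalk_le (Finset.map_nonempty.2 hs) (Finset.map_subset_map.2 hst) hyt
        (subset_stalkSpan _ _ hx)
    obtain ⟨b, hb, hbx⟩ := (mem_stalkSpan_iff_exists (𝔘.affine (Finset.map_nonempty.2 hs))
      ⟨_, hys⟩ hNs x).1 hxs
    have hbu : IsUnitAt (PointRes.incl ζ y) (algebraMap Γ(Z, Us) Z.functionField b) :=
      (isUnitAt_algebraMap_iff (𝔘.affine (Finset.map_nonempty.2 hs)) ⟨_, hys⟩ b).2 hb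
    have hbu₁ := PointRes.isUnitAt_pullback ζ y hys b hbu
    haveI : Nonempty ((PointRes.incl ζ) ⁻¹ᵁ Us) := ⟨⟨_, PointRes.genericPoint_mem_preimage ζ hζs⟩⟩
    have key : lineRes hA hx₂' hAc ⟨_, lineFam_map_le 𝔘 ζ L L' a₀ x₂ h0 s hbx⟩ =
        algebraMap Γ(PointRes.sub ζ, (PointRes.incl ζ) ⁻¹ᵁ Us) (PointRes.sub ζ).functionField
          ((PointRes.incl ζ).app Us b) *
            lineRes hA hx₂' hAc ⟨x, lineFam_map_le 𝔘 ζ L L' a₀ x₂ h0 t hx⟩ :=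
      lineRes_algebraMap_mul hA hx₂' hAc hζs b ⟨x, lineFam_map_le 𝔘 ζ L L' a₀ x₂ h0 t hx⟩
        (lineFam_map_le 𝔘 ζ L L' a₀ x₂ h0 s hbx)
    -- `lineRes x = b₁⁻¹ (b₁ lineRes x)` with `b₁ lineRes x = lineRes (b x) ∈ pieceFam s`
    have hmem : algebraMap Γ(PointRes.sub ζ, (PointRes.incl ζ) ⁻¹ᵁ Us) (PointRes.sub ζ).functionField
          ((PointRes.incl ζ).app Us b) *
            lineRes hA hx₂' hAc ⟨x, lineFam_map_le 𝔘 ζ L L' a₀ x₂ h0 t hx⟩ ∈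
        pieceFam (L := L) hA hx₂' hAc s := by
      have h1 := lineRes_mem_pieceFam hA hx₂' hAc h0 hbx (lineFam_map_le 𝔘 ζ L L' a₀ x₂ h0 s hbx)
      rwa [key] at h1
    have e : lineRes hA hx₂' hAc ⟨x, lineFam_map_le 𝔘 ζ L L' a₀ x₂ h0 t hx⟩ =
        (algebraMap Γ(PointRes.sub ζ, (PointRes.incl ζ) ⁻¹ᵁ Us) (PointRes.sub ζ).functionField
          ((PointRes.incl ζ).app Us b))⁻¹ *
          (algebraMap Γ(PointRes.sub ζ, (PointRes.incl ζ) ⁻¹ᵁ Us) (PointRes.sub ζ).functionField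
            ((PointRes.incl ζ).app Us b) *
              lineRes hA hx₂' hAc ⟨x, lineFam_map_le 𝔘 ζ L L' a₀ x₂ h0 t hx⟩) := by
      rw [← mul_assoc, inv_mul_cancel₀ hbu₁.ne_zero, one_mul]
    rw [SetLike.mem_coe, e]
    exact isRegularAt_mul_mem_stalkSpan hbu₁.inv.isRegularAt (subset_stalkSpan _ _ hmem)

end Piece

end FracFamily

end Literature.AlgebraicGeometry.Motives

end
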